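import Summits.AnomalousDissipation.AnomalousDissipation.Theorems.BaireTransferRobustLoudUpgradeLineCrossingDefs
import Summits.AnomalousDissipation.AnomalousDissipation.Theorems.BaireTransferRobustLoudUpgradeStubSteadyWindow
import Summits.AnomalousDissipation.AnomalousDissipation.Theorems.BaireTransferRobustLoudUpgradeStubCensusInterior
import Summits.AnomalousDissipation.AnomalousDissipation.Theorems.BaireTransferRobustLoudUpgradeStubMalkinBordered
import Summits.AnomalousDissipation.AnomalousDissipation.Theorems.BaireTransferRobustLoudUpgradeStubBorderedCone
import Summits.AnomalousDissipation.AnomalousDissipation.Theorems.BaireTransferRobustLoudUpgradeStubPeriodicWindow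
import Summits.AnomalousDissipation.AnomalousDissipation.Theorems.BaireTransferRobustLoudUpgradeStubSteadyPersistLeaf
import Summits.AnomalousDissipation.AnomalousDissipation.Theorems.BaireTransferRobustLoudUpgradeStubSteadyWindowLeaf
import Summits.AnomalousDissipation.AnomalousDissipation.Theorems.BaireTransferRobustLoudUpgradeStubCrossingPersist
import Summits.AnomalousDissipation.AnomalousDissipation.Theorems.BaireTransferRobustLoudUpgradeStubRobustCrossingClosure
import Summits.AnomalousDissipation.AnomalousDissipation.Theorems.BaireTransferRobustLoudUpgradeStubSubharmonicSign
import Summits.AnomalousDissipation.AnomalousDissipation.Theorems.BaireTransferRobustLoudUpgradeStubLsFamilyB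
import Summits.AnomalousDissipation.AnomalousDissipation.Theorems.BaireTransferRobustLoudUpgradeStubLsFold

/-!
# Line `malkin-cone-group-orbits`, companion c2 ("Lyapunov–Schmidt crossing"): GLUE for the crux
# `BaireTransfer.RobustLoudUpgrade` (stmt-AnomalousDissipation-1144)

GLUE file (pure proofs; every theorem is a short composition of LANDED stubs over the vocabulary of `…LineCrossingDefs.lean`).

SCOPE of the companion.  Among loud steady witnesses with a ONE-dimensional kernel of the linearisation `L(ν,u₀)`, the
generation-1 skeleton v5 reaches the force-VISIBLE degeneracies (`simpleSteady`); this file organises the INVISIBLE ones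
through the genuine Lyapunov–Schmidt family of the witness — the steady lattice map bordered by an ARBITRARY admissible
smooth field `h ∉ range L(ν,u₀)` with the kernel coordinate freed (`LsFamily.stub_lsFamily`, landed): a real function
`σ(c', x)` near `(c, 0)` whose zeros are exactly the mean-zero steady states of `f_{c'}` near `u₀`.

* `crossingSteady` — `σ(c, ·)` takes both signs at `0` (odd index: cusps, pitchfork centres, …): by the intermediate
  value theorem the witness PERSISTS (`CrossingPersist.stub_crossingPersist`), so `⊆ persistSteady ⊆ interior LOUD`.
* `robustCrossingSteady` — sign changes of `σ(c₁, ·)` only at forces `c₁ → c`: `⊆ closure (interior LOUD)`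
  (`RobustCrossingClosure.stub_robustCrossingClosure`).
* `subharmonicSteady` — the first concrete member: a SUBHARMONIC (half-period-translation ℤ₂) pitchfork centre — force and
  witness invariant under a lattice translation `b`, simple `b`-antiperiodic kernel, a `b`-antiperiodic cokernel
  representative `h`, isolation; equivariance + uniqueness make `σ(c, ·)` odd (`SubharmonicSign.stub_subharmonicSign`),
  isolation makes it non-zero off `0`, hence `⊆ crossingSteady` — persistence with NO visibility inside `P_S`.
* `foldSteady` — the second concrete member: a TRANSVERSAL FOLD in the force family — simple kernel `v` with non-zero
  fold coefficient (`(v·∇)v ∉ range L(ν,u₀)`) and ONE first-order-visible force direction `d ∈ P_S`; the saddle-node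
  sign analysis (`LsFold.stub_lsFold`, abstract input `robustCrossing_of_fold`) makes it a robust crossing, hence
  `⊆ robustCrossingSteady` — NO isolation and NO symmetry hypothesis ("a fold is a limit of the two-solution side").
* `ghostSteady` — the complement inside the scope: `σ` ONE-SIGNED on a neighbourhood of `(c, 0)` (the all-directions
  isola centre of the Disproof's VERDICT (K-window)); recorded here only as vocabulary for the residual.
* `tameCrossing` — v4's `tameLeaf` ∪ the four classes; `tameCrossing_subset_closure_interior_loud`; the parametric
  composition `RobustLoudUpgrade_of_residual` / `line_glue_c2` (registered): any tame union upgrading to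
  `closure (interior LOUD)` plus a residual over the unit stock proves the crux BY NAME.

References: Chow–Hale 1982 Ch. 6; Vanderbauwhede 1982 Ch. 8; Kielhöfer 2012 §I.2, §I.5; the route file (item 1144);
`Cruxes/RobustLoudUpgrade/Lines/malkin_cone_group_orbits_c2.lean` (the checked skeleton of this companion).
-/

-- `Summit.<Summit>.<Problem>` is the tree's mandated summit-side namespace (CONVENTIONS §2); for this
-- single-conjunct summit the two coincide, so the duplicate is deliberate.
set_option linter.dupNamespace false

noncomputable section

open scoped BigOperators Topology
open Filter Set Function TopologicalSpace MeasureTheory UnitAddTorus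

namespace Summit.AnomalousDissipation.AnomalousDissipation.Theorems.RobustLoudUpgrade

open Literature.Analysis.FunctionSpaces Literature.Analysis.FunctionSpaces.Torus
open Literature.Analysis.FunctionSpaces.EuclideanSpace
open Literature.Analysis.FluidPDE
open Summit.AnomalousDissipation.AnomalousDissipation.Theses.BaireTransfer

/-! ## §1 Glue: the classes are tame -/

namespace LsCrossing

/-- **(E1)** `crossingSteady ⊆ persistSteady` (landed `CrossingPersist.stub_crossingPersist`). [folklore] -/
theorem crossingSteady_subset_persistSteady (S : Finset (Fin 3 → ℤ)) (a E ε : ℝ) :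
    crossingSteady S a E ε ⊆ persistSteady S a E ε := by
  intro c hc
  obtain ⟨ν, hν, hνa, u₀, p₀, hst, h0, hE, hε, σ, hfam, hsign⟩ := hc
  exact ⟨ν, hν, hνa, u₀, p₀, hst, h0, hE, hε, CrossingPersist.stub_crossingPersist S c ν u₀ σ hfam hsign⟩

/-- **(E1), concluded**: `crossingSteady ⊆ interior LOUD` at the same strict budgets (landed `stub_steadyWindow`).
[folklore] -/
theorem crossingSteady_subset_interior_loud (S : Finset (Fin 3 → ℤ)) (a E ε : ℝ) :
    crossingSteady S a E ε ⊆ interior (loud S a E ε) :=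
  (crossingSteady_subset_persistSteady S a E ε).trans (SteadyWindow.stub_steadyWindow S a E ε)

/-- **(E2)** `robustCrossingSteady ⊆ closure (interior LOUD)` at the same strict budgets (landed
`RobustCrossingClosure.stub_robustCrossingClosure`). [folklore] -/
theorem robustCrossingSteady_subset_closure_interior_loud (S : Finset (Fin 3 → ℤ)) (a E ε : ℝ) :
    robustCrossingSteady S a E ε ⊆ closure (interior (loud S a E ε)) := by
  intro c hc
  obtain ⟨ν, hν, hνa, u₀, p₀, hst, -, hE, hε, σ, hfam, hsign⟩ := hc
  refine RobustCrossingClosure.stub_robustCrossingClosure S a E ε c ν u₀ p₀ σ hν hνa hst hE hε (fun δ hδ => ?_) hsign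
  obtain ⟨r, hr, hcont, hzero⟩ := hfam δ hδ
  exact ⟨r, hr, hcont, fun q hq hσ => by
    obtain ⟨u', p', hst', -, hd⟩ := hzero q hq hσ
    exact ⟨u', p', hst', hd⟩⟩

/-- **`subharmonicSteady ⊆ crossingSteady`** (from the landed `LsFamily.stub_lsFamily` and
`SubharmonicSign.stub_subharmonicSign`): the Lyapunov–Schmidt family bordered by `h` supplies `σ`; its zeros are steady
states of the uncorrected forces; ISOLATION makes `σ(c, x) ≠ 0` for small `x ≠ 0` (a zero would be a steady state of
`f_c` itself, `H¹`-close to `u₀`, hence `= u₀`, of phase `x ≠ 0` — absurd); ODDNESS then puts both signs next to `0`.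
[folklore] -/
theorem subharmonicSteady_subset_crossingSteady (S : Finset (Fin 3 → ℤ)) (a E ε : ℝ) :
    subharmonicSteady S a E ε ⊆ crossingSteady S a E ε := by
  intro c hc
  obtain ⟨b, hodd, ν, hν, hνa, u₀, p₀, hst, h0, hE, hε, hu₀odd, ⟨ρ₁, hρ₁, hiso⟩, v, h, hv₁, hv₂, hv₃, hveven, hker,
    hh₁, hh₂, hh₃, hheven, hvis⟩ := hc
  have hsm₀ : IsSmooth u₀ := hst.smooth_velocity.isSmooth_slice (Set.mem_univ (0 : ℝ))
  obtain ⟨σ, -, -, hfam, ρ, hρ, huniq⟩ :=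
    LsFamily.stub_lsFamily S c ν u₀ p₀ v h hν hst h0 hv₁ hv₂ hv₃ hker hh₁ hh₂ hh₃ hvis
  -- the family clause, specialised to `c' = c`
  have hfam_c : ∀ δ : ℝ, 0 < δ → ∃ r : ℝ, 0 < r ∧ ∀ x : ℝ, |x| < r → |σ (c, x)| < δ ∧
      ∃ (u' : UnitAddTorus (Fin 3) → EuclideanSpace ℝ (Fin 3)) (p' : UnitAddTorus (Fin 3) → ℝ),
        Torus.IsSteadyNSState ν (fun y => force S c y - σ (c, x) • h y) u' p' ∧ HasZeroMean u' ∧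
        (∑' k : Fin 3 → ℤ, freqNormSq k ^ 2 *
            ‖mFourierCoeff (complexify ∘ u') k - mFourierCoeff (complexify ∘ u₀) k‖ ^ 2) < δ ∧
        (∫ y, inner ℝ (v y) (u' y - u₀ y)) = x := by
    intro δ hδ
    obtain ⟨r, hr, -, hball⟩ := hfam δ hδ
    refine ⟨r, hr, fun x hx => ?_⟩
    obtain ⟨hσ, u', p', hst', hm', -, hlat, hph⟩ := hball (c, x) (mk_mem_ball c hx)
    exact ⟨hσ, u', p', hst', hm', hlat, hph⟩
  -- oddness of `σ(c, ·)` near `0`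
  obtain ⟨r₀, hr₀, hoddσ⟩ := SubharmonicSign.stub_subharmonicSign S c ν b u₀ v h σ ρ hodd hu₀odd hveven hheven hsm₀
    hv₁ hfam_c hρ (fun x t u'' p'' hx ht hst'' hm'' hlat hph => huniq c x t u'' p'' (by rw [dist_self]; exact hρ) hx ht
      hst'' hm'' hlat hph)
  refine ⟨ν, hν, hνa, u₀, p₀, hst, h0, hE, hε, σ, fun δ hδ => ?_, fun η hη => ?_⟩
  · -- zeros of `σ` are steady states of the uncorrected force
    obtain ⟨r, hr, hcont, hball⟩ := hfam δ hδ
    refine ⟨r, hr, hcont, fun q hq hσq => ?_⟩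
    obtain ⟨-, u', p', hst', hm', hd, -, -⟩ := hball q hq
    refine ⟨u', p', ?_, hm', hd⟩
    have e : (fun y => force S q.1 y - σ q • h y) = force S q.1 := by
      funext y; rw [hσq, zero_smul, sub_zero]
    rwa [e] at hst'
  · -- isolation ⇒ `σ(c, x) ≠ 0` for small `x ≠ 0`; oddness ⇒ both signs
    obtain ⟨r, hr, -, hball⟩ := hfam ρ₁ hρ₁
    have hne : ∀ x : ℝ, |x| < r → x ≠ 0 → σ (c, x) ≠ 0 := by
      intro x hx hx0 hσx
      obtain ⟨-, u', p', hst', hm', hd, -, hph⟩ := hball (c, x) (mk_mem_ball c hx)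
      have e : (fun y => force S ((c, x) : Coeff S × ℝ).1 y - σ (c, x) • h y) = force S c := by
        funext y; rw [hσx, zero_smul, sub_zero]
      rw [e] at hst'
      have hu' : u' = u₀ := hiso u' p' hst' hm' hd
      rw [hu'] at hph
      simp only [sub_self, inner_zero_right, integral_zero] at hph
      exact hx0 hph.symm
    set x : ℝ := min (η / 2) (min (r / 2) (r₀ / 2)) with hx
    have hx0 : 0 < x := lt_min (by linarith) (lt_min (by linarith) (by linarith))
    have hxη : |x| < η := by rw [abs_of_pos hx0]; exact (min_le_left _ _).trans_lt (by linarith)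
    have hxr : |x| < r := by
      rw [abs_of_pos hx0]; exact ((min_le_right _ _).trans (min_le_left _ _)).trans_lt (by linarith)
    have hxr₀ : |x| < r₀ := by
      rw [abs_of_pos hx0]; exact ((min_le_right _ _).trans (min_le_right _ _)).trans_lt (by linarith)
    have hσx : σ (c, x) ≠ 0 := hne x hxr hx0.ne'
    have hσnx : σ (c, -x) = -σ (c, x) := hoddσ x hxr₀
    have hnxη : |(-x)| < η := by rwa [abs_neg]
    rcases lt_or_gt_of_ne hσx with hneg | hpos
    · exact ⟨x, -x, hxη, hnxη, hneg, by rw [hσnx]; linarith⟩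
    · exact ⟨-x, x, hnxη, hxη, by rw [hσnx]; linarith, hpos⟩

/-- **`subharmonicSteady ⊆ interior LOUD`**: subharmonic pitchfork centres are robustly loud forces outright.
[folklore] -/
theorem subharmonicSteady_subset_interior_loud (S : Finset (Fin 3 → ℤ)) (a E ε : ℝ) :
    subharmonicSteady S a E ε ⊆ interior (loud S a E ε) :=
  (subharmonicSteady_subset_crossingSteady S a E ε).trans (crossingSteady_subset_interior_loud S a E ε)

/-- **`foldSteady ⊆ robustCrossingSteady`** (from the landed `LsFamily.stub_lsFamily` and `LsFold.stub_lsFold`, run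
with the border field `h := f_d`): the fold family `σ₂` changes sign in `x` at forces `c + s d → c`; by the UNIQUENESS clause
of `stub_lsFamily` it coincides near `(c, 0)` with the family `σ₁` whose zeros are known to be steady states of the
uncorrected forces; so `σ₁` is a robust crossing. [folklore] -/
theorem foldSteady_subset_robustCrossingSteady (S : Finset (Fin 3 → ℤ)) (a E ε : ℝ) :
    foldSteady S a E ε ⊆ robustCrossingSteady S a E ε := by
  intro c hc
  obtain ⟨ν, hν, hνa, u₀, p₀, hst, h0, hE, hε, v, d, hv₁, hv₂, hv₃, hker, hfold, hvisd⟩ := hc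
  -- the border field `h := f_d` is admissible and visible
  have hh₁ : IsSmooth (force S d) := SteadyPersist.isSmooth_force' d
  have hh₂ : IsDivFree (force S d) := SteadyPersist.isDivFree_force' d
  have hh₃ : HasZeroMean (force S d) := SteadyPersist.hasZeroMean_force' d
  obtain ⟨σ₁, -, -, hfam, ρ, hρ, huniq⟩ :=
    LsFamily.stub_lsFamily S c ν u₀ p₀ v (force S d) hν hst h0 hv₁ hv₂ hv₃ hker hh₁ hh₂ hh₃ hvisd
  obtain ⟨σ₂, hex₂, hsign₂⟩ :=
    LsFold.stub_lsFold S c d ν u₀ p₀ v (force S d) hν hst h0 hv₁ hv₂ hv₃ hker hh₁ hh₂ hh₃ hvisd hfold hvisd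
  -- `σ₂ = σ₁` on a ball around `(c, 0)`
  obtain ⟨r₂, hr₂, hball₂⟩ := hex₂ ρ hρ
  have heq : ∀ q ∈ Metric.ball ((c, 0) : Coeff S × ℝ) (min r₂ ρ), σ₂ q = σ₁ q := by
    intro q hq
    have hq₂ : q ∈ Metric.ball ((c, 0) : Coeff S × ℝ) r₂ := Metric.ball_subset_ball (min_le_left _ _) hq
    have hqρ : dist q (c, 0) < ρ := lt_of_lt_of_le (Metric.mem_ball.1 hq) (min_le_right _ _)
    rw [Prod.dist_eq, Real.dist_eq, sub_zero] at hqρ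
    obtain ⟨hσ, u', p', hst', hm', hlat, hph⟩ := hball₂ q hq₂
    exact huniq q.1 q.2 (σ₂ q) u' p' (lt_of_le_of_lt (le_max_left _ _) hqρ)
      (lt_of_le_of_lt (le_max_right _ _) hqρ) hσ hst' hm' hlat hph
  refine ⟨ν, hν, hνa, u₀, p₀, hst, h0, hE, hε, σ₁, fun δ hδ => ?_, fun η hη => ?_⟩
  · -- zeros of `σ₁` are steady states of the uncorrected force
    obtain ⟨r, hr, hcont, hball⟩ := hfam δ hδ
    refine ⟨r, hr, hcont, fun q hq hσq => ?_⟩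
    obtain ⟨-, u', p', hst', hm', hd, -, -⟩ := hball q hq
    refine ⟨u', p', ?_, hm', hd⟩
    have e : (fun y => force S q.1 y - σ₁ q • force S d y) = force S q.1 := by
      funext y; rw [hσq, zero_smul, sub_zero]
    rwa [e] at hst'
  · -- the robust sign change of `σ₂`, transported to `σ₁`
    obtain ⟨s, x₁, x₂, hs, hx₁, hx₂, hσ₁, hσ₂⟩ := hsign₂ (min η (min r₂ ρ)) (lt_min hη (lt_min hr₂ hρ))
    have hmem : ∀ x : ℝ, |x| < min η (min r₂ ρ) → ((c + s • d, x) : Coeff S × ℝ) ∈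
        Metric.ball ((c, 0) : Coeff S × ℝ) (min r₂ ρ) := fun x hx => by
      rw [Metric.mem_ball, Prod.dist_eq, Real.dist_eq, sub_zero]
      exact max_lt (lt_of_lt_of_le hs (min_le_right _ _)) (lt_of_lt_of_le hx (min_le_right _ _))
    refine ⟨c + s • d, x₁, x₂, lt_of_lt_of_le hs (min_le_left _ _), lt_of_lt_of_le hx₁ (min_le_left _ _),
      lt_of_lt_of_le hx₂ (min_le_left _ _), ?_, ?_⟩
    · rw [← heq _ (hmem x₁ hx₁)]; exact hσ₁
    · rw [← heq _ (hmem x₂ hx₂)]; exact hσ₂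

/-- **`foldSteady ⊆ closure (interior LOUD)`**: transversal folds are limits of robustly loud forces. [folklore] -/
theorem foldSteady_subset_closure_interior_loud (S : Finset (Fin 3 → ℤ)) (a E ε : ℝ) :
    foldSteady S a E ε ⊆ closure (interior (loud S a E ε)) :=
  (foldSteady_subset_robustCrossingSteady S a E ε).trans (robustCrossingSteady_subset_closure_interior_loud S a E ε)

/-! ## §2 Composition: the enlarged tame union and the registered line glue -/

/-- **Every tame witness class of v4 is force-open up to closure** (the six LANDED upgrade theorems). [folklore] -/
theorem tameLeaf_subset_closure_interior_loud (S : Finset (Fin 3 → ℤ)) (a E ε : ℝ) :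
    tameLeaf S a E ε ⊆ closure (interior (loud S a E ε)) :=
  tameLeaf_subset_closure_interior SteadyPersistLeaf.stub_steadyPersistLeaf SteadyWindowLeaf.stub_steadyWindowLeaf
    CensusInterior.stub_censusInterior MalkinBordered.stub_malkinBordered BorderedCone.stub_borderedCone
    PeriodicWindow.stub_periodicWindow S a E ε

/-- **The enlarged tame union is force-open up to closure.** [folklore] -/
theorem tameCrossing_subset_closure_interior_loud (S : Finset (Fin 3 → ℤ)) (a E ε : ℝ) :
    tameCrossing S a E ε ⊆ closure (interior (loud S a E ε)) := by
  refine Set.union_subset (Set.union_subset (Set.union_subset (Set.union_subset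
    (tameLeaf_subset_closure_interior_loud S a E ε) ?_) (robustCrossingSteady_subset_closure_interior_loud S a E ε)) ?_)
    (foldSteady_subset_closure_interior_loud S a E ε)
  · exact (crossingSteady_subset_interior_loud S a E ε).trans subset_closure
  · exact (subharmonicSteady_subset_interior_loud S a E ε).trans subset_closure

/-- **Line glue of the companion c2, curried (registered sub-goal `line_glue_c2`)**: the residual over the enlarged tame
union `tameCrossing` proves the crux (by `RobustLoudUpgrade_of_residual` and `tameCrossing_subset_closure_interior_loud`).
[folklore] -/
theorem line_glue_c2 : (∀ S : Finset (Fin 3 → ℤ), unitStock ⊆ S → ∀ (a E ε : ℝ), 0 < a → 0 < ε → loud S a E ε ⊆ closure (tameCrossing S a (2 * E) (ε / 2))) → RobustLoudUpgrade :=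
  fun hRes => RobustLoudUpgrade_of_residual (fun S a E ε => tameCrossing S a E ε)
    tameCrossing_subset_closure_interior_loud hRes

end LsCrossing

end Summit.AnomalousDissipation.AnomalousDissipation.Theorems.RobustLoudUpgrade

end
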